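/-
Copyright (c) 2026 the pub-hodgecm-mathlib formalisation cell (harness21).  Prover seat hodgecm-mathlib-K2Liu-p11 (g0), Track B «K2-LIT»,
#184♮ = hLiu418 = `stmt-HodgeConjecture-24832`; LEAD F0P6-plan (g12) RULING M-156n (4) «A∞ ORGAN»; K2E5-plan (g6) 08:24:53Z «= n = 2 by hand».
File (A∞-B1), part 1: the `tan`- and `sin²`-substitutions (Mathlib-only).  THEOREMS ONLY (no `def`, no `instance`, no notation,
no named-fact hypothesis, no `sorry`).
-/
import Mathlib.Analysis.SpecialFunctions.Gamma.Beta
import Mathlib.Analysis.SpecialFunctions.Trigonometric.ArctanDeriv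
import Mathlib.MeasureTheory.Function.Jacobian
import HarnessLib

/-!
# Crux `HLiu418`, A∞ organ, (A∞-B1) part 1: the substitutions `x = tan θ` on `ℝ` and `t = sin² θ` on `(0, 1)`

Cell `hodgecm-mathlib`, crux item hLiu418 = `stmt-HodgeConjecture-24832` (helper lane `--supports`, count-neutral).
The base Γ-integral of the archimedean intertwining operator (★ `archIntertwining_archScalarSection_one`) is reduced, at `l = Fin 2` and
after Weyl integration, to one-dimensional integrals `∫_ℝ λ^m (λ+i)^{−k} (1+λ²)^{w} dλ`; these are brought to trigonometric Beta integrals by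
`x = tan θ`, and the base case to Euler's Beta function by `t = sin² θ`.  This part records the two changes of variables:
* `integral_comp_tan` — `∫_ℝ g = ∫_{θ ∈ (−π/2, π/2)} (cos θ)⁻² · g (tan θ)` (★ `integral_image_eq_integral_abs_deriv_smul`, ★ `Real.surjOn_tan`,
  `Real.injOn_tan`, `Real.hasDerivAt_tan`);
* `integral_Ioo_comp_sin_sq` — `∫_{t ∈ (0,1)} h t = ∫_{θ ∈ (0, π/2)} (2 sin θ cos θ) · h (sin² θ)`.
References: [Shimura1982, (1.16)] (general `n`; acq-15218 open — not used); [folklore] (Euler Beta integrals).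
HONEST LABEL: HC_CM is proved only modulo the 7 printed citations (2 remaining named inputs: hLiu418 = stmt-HodgeConjecture-24832,
h413 = stmt-HodgeConjecture-24833) until rung 0 closes; count-neutral helper, closes no socket.
-/

set_option autoImplicit false
set_option linter.dupNamespace false

noncomputable section

open Real Set MeasureTheory

namespace Summit.HodgeConjecture.HodgeConjecture.Cruxes.HLiu418.K2LiuCayleyBetaIntegral

/-! ## 1. `x = tan θ` -/

/-- **The `tan`-substitution on the whole line**: `∫_ℝ g = ∫_{θ ∈ (−π/2, π/2)} (cos θ)⁻² · g (tan θ)` (Bochner integrals, any `g`).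
[folklore] -/
theorem integral_comp_tan {F : Type*} [NormedAddCommGroup F] [NormedSpace ℝ F] (g : ℝ → F) :
    ∫ x : ℝ, g x = ∫ θ in Ioo (-(π / 2)) (π / 2), (1 / Real.cos θ ^ 2) • g (Real.tan θ) := by
  have himage : Real.tan '' Ioo (-(π / 2)) (π / 2) = univ :=
    eq_univ_of_forall fun x => Real.surjOn_tan (mem_univ x)
  have hderiv : ∀ θ ∈ Ioo (-(π / 2)) (π / 2), HasDerivWithinAt Real.tan (1 / Real.cos θ ^ 2) (Ioo (-(π / 2)) (π / 2)) θ :=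
    fun θ hθ => (Real.hasDerivAt_tan (Real.cos_pos_of_mem_Ioo hθ).ne').hasDerivWithinAt
  have h := integral_image_eq_integral_abs_deriv_smul measurableSet_Ioo hderiv Real.injOn_tan g
  rw [himage, setIntegral_univ] at h
  rw [h]
  refine setIntegral_congr_fun measurableSet_Ioo fun θ hθ => ?_
  rw [abs_of_pos (by have := Real.cos_pos_of_mem_Ioo hθ; positivity)]

/-! ## 2. `t = sin² θ` -/

/-- **The `sin²`-substitution**: `∫_{t ∈ (0,1)} h t = ∫_{θ ∈ (0, π/2)} (2 sin θ cos θ) · h (sin² θ)`. [folklore] -/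
theorem integral_Ioo_comp_sin_sq {F : Type*} [NormedAddCommGroup F] [NormedSpace ℝ F] (h : ℝ → F) :
    ∫ t in Ioo (0 : ℝ) 1, h t = ∫ θ in Ioo (0 : ℝ) (π / 2), (2 * Real.sin θ * Real.cos θ) • h (Real.sin θ ^ 2) := by
  -- `θ ↦ sin² θ` is an injective smooth map of `(0, π/2)` onto `(0, 1)`
  have hderiv : ∀ θ ∈ Ioo (0 : ℝ) (π / 2),
      HasDerivWithinAt (fun θ => Real.sin θ ^ 2) (2 * Real.sin θ * Real.cos θ) (Ioo (0 : ℝ) (π / 2)) θ := by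
    intro θ _
    have h1 := (Real.hasDerivAt_sin θ).pow 2
    simp only [Nat.cast_ofNat] at h1
    refine (h1.congr_deriv ?_).hasDerivWithinAt
    ring
  have hinj : InjOn (fun θ => Real.sin θ ^ 2) (Ioo (0 : ℝ) (π / 2)) := by
    intro θ₁ h₁ θ₂ h₂ h
    have hs₁ : 0 < Real.sin θ₁ := Real.sin_pos_of_mem_Ioo ⟨h₁.1, h₁.2.trans (by linarith [Real.pi_pos])⟩
    have hs₂ : 0 < Real.sin θ₂ := Real.sin_pos_of_mem_Ioo ⟨h₂.1, h₂.2.trans (by linarith [Real.pi_pos])⟩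
    have heq : Real.sin θ₁ = Real.sin θ₂ := by
      have := (sq_eq_sq₀ hs₁.le hs₂.le).1 h
      exact this
    exact Real.injOn_sin ⟨by linarith [h₁.1, Real.pi_pos], by linarith [h₁.2, Real.pi_pos]⟩
      ⟨by linarith [h₂.1, Real.pi_pos], by linarith [h₂.2, Real.pi_pos]⟩ heq
  have himage : (fun θ => Real.sin θ ^ 2) '' Ioo (0 : ℝ) (π / 2) = Ioo 0 1 := by
    ext t
    constructor
    · rintro ⟨θ, hθ, rfl⟩
      have hs : 0 < Real.sin θ := Real.sin_pos_of_mem_Ioo ⟨hθ.1, hθ.2.trans (by linarith [Real.pi_pos])⟩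
      have hc : 0 < Real.cos θ := Real.cos_pos_of_mem_Ioo ⟨by linarith [hθ.1, Real.pi_pos], hθ.2⟩
      refine ⟨by positivity, ?_⟩
      have : Real.sin θ ^ 2 + Real.cos θ ^ 2 = 1 := Real.sin_sq_add_cos_sq θ
      nlinarith [sq_pos_of_pos hc]
    · rintro ⟨ht0, ht1⟩
      refine ⟨Real.arcsin (Real.sqrt t), ⟨?_, ?_⟩, ?_⟩
      · exact Real.arcsin_pos.2 (Real.sqrt_pos.2 ht0)
      · rw [Real.arcsin_lt_pi_div_two]
        rw [Real.sqrt_lt' one_pos, one_pow]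
        exact ht1
      · simp only
        rw [Real.sin_arcsin (by linarith [Real.sqrt_nonneg t]) ((Real.sqrt_le_one (x := t)).2 ht1.le), Real.sq_sqrt ht0.le]
  have hmain := integral_image_eq_integral_abs_deriv_smul measurableSet_Ioo hderiv hinj h
  rw [himage] at hmain
  rw [hmain]
  refine setIntegral_congr_fun measurableSet_Ioo fun θ hθ => ?_
  have hs : 0 < Real.sin θ := Real.sin_pos_of_mem_Ioo ⟨hθ.1, hθ.2.trans (by linarith [Real.pi_pos])⟩
  have hc : 0 < Real.cos θ := Real.cos_pos_of_mem_Ioo ⟨by linarith [hθ.1, Real.pi_pos], hθ.2⟩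
  rw [abs_of_pos (by positivity)]

end Summit.HodgeConjecture.HodgeConjecture.Cruxes.HLiu418.K2LiuCayleyBetaIntegral

end
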